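import Literature.AlgebraicGeometry.Modules.SerreTheoremA
import Literature.AlgebraicGeometry.Motives.ProjectiveLineUniformisers
import Literature.AlgebraicGeometry.Modules.AffineVectorBundleSections
import Literature.AlgebraicGeometry.Modules.KernelFiniteLocallyFree
import Literature.AlgebraicGeometry.Modules.FrameTransition
import Summits.ResolutionOfSingularities.ResolutionOfSingularities.Theorems.EquisingularLiftEquisingularLiftNatP1VBProjectiveLine
import Mathlib.LinearAlgebra.FreeModule.PID
import Mathlib.RingTheory.Localization.Away.Basic
import HarnessLib

/-!
# [OURS · L1 W4.5(b) · T-P1VB part 6] `Pic ℙ¹_k` in frame form: a line bundle on the projective line over a field is free on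
# the two standard charts, with transition function a monomial `(x₁/x₀)^a (x₀/x₁)^b`

Cell res-hironaka, LADDER-RESOLUTION rung L (D-0089), slot W4.5(b), crux `Theses.EquisingularLift.EquisingularLiftNat`
(stmt-ResolutionOfSingularities-20038) / child `EquisingularLiftNatThree` (stmt-ResolutionOfSingularities-20148); object **T-P1VB**
(res-L1-w45b-lead-2 BOOK 2026-08-27T09:28:20Z; LEAD-MEMO-5 v8 «VOCABULARY: degree / splitting type of … bundles on ℙ¹_k»; supplier
debt (c) of `Cruxes/…/DIRSTEP.lean`: lifting the downstairs line bundle `K₀` to the `O`-curve), `--supports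
stmt-ResolutionOfSingularities-20148 --as helper`. NOT a statement of any manuscript; OURS. AI-written; AI review is weaker than
expert review.

THEOREM (`exists_frames_transition_eq_monomial`). `k` a field, `L` an `𝒪`-module on `ℙ¹_k = ProjCech.PP k 1` which is free of rank
one near every point. Then there are frames `e₀ : 𝒪 ≅ L|_{D₊(x₀)}`, `e₁ : 𝒪 ≅ L|_{D₊(x₁)}` on the WHOLE standard charts and
`a b : ℕ` with transition function `T(e₀,e₁) = (x₁/x₀)|^a · (x₀/x₁)|^b` on `D₊(x₀) ∩ D₊(x₁)` (tree `FrameTransition.transition`,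
`SerreTwist.chartFun (𝟙 ℙ¹) 1 0 = x₁/x₀`). I.e. `L ≅ 𝒪(±d)`; with the tree's `Modules/MatrixCocycleGluing` and
`PullbackFrame.transition_pullbackFrame` the cocycle lifts verbatim over `ℙ¹_O` (the v8 supplier's lift of `K₀`). No Grothendieck
splitting, no divisors, no named facts.

PROOF. (1) `exists_eq_unit_mul_zpow_of_isUnit` — algebra: units of `R[1/t]` for a prime `t` of a domain are `u·tᵈ`, `u ∈ Rˣ`,
`d ∈ ℤ` (`a b = tⁿ⁺ᵐ ⇒ a ~ tⁱ`, Mathlib `dvd_prime_pow`). (2) Charts: `Γ(ℙ¹_k, D₊(x_i)) ≅ k[T]` (Mathlib `Proj.basicOpenIsoAway` +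
tree `ProjLine.ψ'`, transported along `D₊(X_{{i}}) = D₊(x_i)`) is a PID and a domain (`isPrincipalIdealRing_sections_Dplus`,
`isDomain_sections_Dplus`); `x₁/x₀` is PRIME in `Γ(D₊(x₀))` (`prime_chartFun`: it generates the maximal ideal of the rational
point `(1:0)`, tree `ProjLine.primeIdealOf_y`; `chartFun_eq_sec` identifies the two spellings of `x₁/x₀`). (3) `exists_frame_Dplus`:
sections of `L` over the affine chart are finite projective over the PID (tree `AffineVectorBundleSections`), hence free
(Mathlib), of rank one (compare with a rank-one frame at `(1:0)`, tree `FrameTransition.rank_eq_of_nontrivial`), so `L` is free on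
the chart (tree `KernelFiniteLocallyFree.nonempty_free_iso_over_of_basis`). (4) The `1×1` transition over
`D₊(x₀) ∩ D₊(x₁) = D(x₁/x₀)` (tree `SerreTheoremA.Zop_singleton_inf_eq_basicOpen`; a localization of `Γ(D₊(x₀))` at the prime
`x₁/x₀`, Mathlib `IsAffineOpen.isLocalization_basicOpen`) is a unit, hence `u·(x₁/x₀)ᵈ`; `u` is absorbed into `e₀`
(`overScalar`), and `(x₁/x₀)⁻¹ = x₀/x₁` (tree `chartFun_mul_symm`).

References (index only): Hartshorne II Prop. 2.5, II.6 (`Pic ℙ¹ = ℤ`), II Ex. 5.18; Görtz–Wedhorn I §(11.17).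
-/

noncomputable section

-- `TopCat.Presheaf`/`Scheme.Modules` are not reducible (as in Mathlib's `AlgebraicGeometry/Modules`).
set_option backward.isDefEq.respectTransparency false

open CategoryTheory AlgebraicGeometry TopologicalSpace Opposite
open Literature.AlgebraicGeometry.Morphisms Literature.AlgebraicGeometry.Modules Literature.AlgebraicGeometry
open Literature.Algebra.Homology.LaurentCech (Xs Xs_mem Xs_singleton)

universe u

attribute [local instance] MvPolynomial.gradedAlgebra Literature.AlgebraicGeometry.Motives.ProjBaseChange.algebraBase

set_option linter.dupNamespace false -- mandated namespace `Summit.<Summit>.<Problem>` of this single-conjunct summit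

namespace Summit.ResolutionOfSingularities.ResolutionOfSingularities.Cruxes.EquisingularLiftNat.P1VB

/-! ### Algebra: units of `R[1/t]` for a prime `t` of a domain -/

section Algebra

variable {R S : Type*} [CommRing R] [IsDomain R] [CommRing S] [Algebra R S] (t : R) [IsLocalization.Away t S]

/-- **Units of `R[1/t]`, `t` a prime of the domain `R`, are `u · tᵈ` with `u ∈ Rˣ`, `d ∈ ℤ`** (`v = a/tⁿ` with
`a b = tⁿ⁺ᵐ` forces `a ~ tⁱ`). [folklore] -/
theorem exists_eq_unit_mul_zpow_of_isUnit (ht : Prime t) {v : S} (hv : IsUnit v) :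
    ∃ (u : Rˣ) (d : ℤ), v = algebraMap R S u *
      (((IsLocalization.Away.algebraMap_isUnit (S := S) t).unit ^ d : Sˣ) : S) := by
  set tU : Sˣ := (IsLocalization.Away.algebraMap_isUnit (S := S) t).unit with htU
  obtain ⟨w, hw⟩ := hv.exists_right_inv
  obtain ⟨n, a, ha⟩ := IsLocalization.Away.surj t v
  obtain ⟨m, b, hb⟩ := IsLocalization.Away.surj t w
  have hinj : Function.Injective (algebraMap R S) :=
    IsLocalization.injective S (powers_le_nonZeroDivisors_of_noZeroDivisors ht.ne_zero)
  have hab : a * b = t ^ (n + m) := by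
    apply hinj
    rw [map_mul, ← ha, ← hb, mul_mul_mul_comm, hw, one_mul, ← pow_add, ← map_pow]
  have hdvd : a ∣ t ^ (n + m) := ⟨b, hab.symm⟩
  obtain ⟨i, -, u, hu⟩ := (dvd_prime_pow ht _).mp hdvd
  have ha' : a = t ^ i * ↑u⁻¹ := (Units.eq_mul_inv_iff_mul_eq (c := u)).mpr hu
  refine ⟨u⁻¹, (i : ℤ) - n, ?_⟩
  have htu : (algebraMap R S t) = (tU : S) := rfl
  have hcancel : (algebraMap R S t) ^ n * ((tU⁻¹ ^ n : Sˣ) : S) = 1 := by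
    rw [htu, ← Units.val_pow_eq_pow_val, ← Units.val_mul, ← mul_pow, mul_inv_cancel, one_pow, Units.val_one]
  have hv' : v = algebraMap R S a * ((tU⁻¹ ^ n : Sˣ) : S) := by
    rw [← ha, mul_assoc, hcancel, mul_one]
  have hau : algebraMap R S a = algebraMap R S (↑u⁻¹ : R) * ((tU ^ (i : ℤ) : Sˣ) : S) := by
    rw [ha', map_mul, map_pow, htu, zpow_natCast, Units.val_pow_eq_pow_val, mul_comm]
  rw [hv', hau, mul_assoc, ← Units.val_mul]
  congr 2
  rw [← zpow_natCast tU⁻¹, inv_zpow, ← zpow_neg, ← zpow_add, sub_eq_add_neg]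

end Algebra

/-! ### The standard charts of `ℙ¹_k`: `Γ(D₊(x_i)) ≅ k[T]` is a PID, `x₁/x₀` is prime in `Γ(D₊(x₀))` -/

section Charts

variable (k : Type u) [Field k]

/-- `D₊(X_{{i}}) = D₊(x_i)` (`Xs {i} = x_i`). [folklore] -/
theorem Dplus_singleton_eq (i : Fin 2) :
    ProjCech.Dplus k 1 {i} = Proj.basicOpen (ProjCech.grading k 1) (MvPolynomial.X i) :=
  congrArg (Proj.basicOpen (ProjCech.grading k 1)) (Xs_singleton i)

/-- **`Γ(ℙ¹_k, D₊(x_i)) ≅ k[T]`** as rings (Mathlib `Proj.basicOpenIsoAway`, tree `ProjLine.ψ'`). [folklore] -/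
theorem nonempty_ringEquiv_polynomial (i : Fin 2) :
    Nonempty (Γ(ProjCech.PP k 1, ProjCech.Dplus k 1 {i}) ≃+* Polynomial k) := by
  have e1 : Γ(ProjCech.PP k 1, ProjCech.Dplus k 1 {i}) ≅
      Γ(ProjCech.PP k 1, Proj.basicOpen (ProjCech.grading k 1) (MvPolynomial.X i)) :=
    (ProjCech.PP k 1).presheaf.mapIso (eqToIso (Dplus_singleton_eq k i)).symm.op
  have e2 : Γ(ProjCech.PP k 1, Proj.basicOpen (ProjCech.grading k 1) (MvPolynomial.X i)) ≅
      CommRingCat.of (HomogeneousLocalization.Away (ProjCech.grading k 1) (MvPolynomial.X i : MvPolynomial (Fin 2) k)) :=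
    (Proj.basicOpenIsoAway (ProjCech.grading k 1) (MvPolynomial.X i) (Motives.Segre.X_mem k i) one_pos).symm
  exact ⟨(e1 ≪≫ e2).commRingCatIsoToRingEquiv.trans (Motives.ProjLine.ψ' k i).toRingEquiv⟩

/-- `Γ(ℙ¹_k, D₊(x_i))` is a domain. [folklore] -/
theorem isDomain_sections_Dplus (i : Fin 2) : IsDomain Γ(ProjCech.PP k 1, ProjCech.Dplus k 1 {i}) := by
  obtain ⟨e⟩ := nonempty_ringEquiv_polynomial k i
  exact e.toMulEquiv.isDomain

/-- `Γ(ℙ¹_k, D₊(x_i))` is a principal ideal ring. [folklore] -/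
theorem isPrincipalIdealRing_sections_Dplus (i : Fin 2) :
    IsPrincipalIdealRing Γ(ProjCech.PP k 1, ProjCech.Dplus k 1 {i}) := by
  obtain ⟨e⟩ := nonempty_ringEquiv_polynomial k i
  exact IsPrincipalIdealRing.of_surjective e.symm.toRingHom e.symm.surjective

/-- Transport of `awayToSection` of a degree-one fraction along an equality of the denominators. [folklore] -/
theorem map_eqToHom_awayToSection_mk {f f' p p' : MvPolynomial (Fin 2) k} (h : f = f') (hp' : p = p')
    {d : ℕ} (hf : f ∈ ProjCech.grading k 1 d) (hf' : f' ∈ ProjCech.grading k 1 d) (n : ℕ)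
    (hp : p ∈ ProjCech.grading k 1 (n • d)) (hpp : p' ∈ ProjCech.grading k 1 (n • d)) :
    (ProjCech.PP k 1).presheaf.map
        (eqToHom (congrArg (Proj.basicOpen (ProjCech.grading k 1)) h :
          Proj.basicOpen (ProjCech.grading k 1) f = Proj.basicOpen (ProjCech.grading k 1) f')).op
        (Proj.awayToSection (ProjCech.grading k 1) f' (HomogeneousLocalization.Away.mk _ hf' n p' hpp)) =
      Proj.awayToSection (ProjCech.grading k 1) f (HomogeneousLocalization.Away.mk _ hf n p hp) := by
  subst h; subst hp'
  rw [eqToHom_refl, op_id, CategoryTheory.Functor.map_id]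
  rfl

/-- **`x₁/x₀`**: the tree's chart function `chartFun (𝟙 ℙ¹) 1 0 ∈ Γ(ℙ¹_k, D₊(x₀))` is the section `ProjLine.sec k 0`
(transported along `D₊(X_{{0}}) = D₊(x₀)`). [folklore] -/
theorem chartFun_eq_sec :
    SerreTwist.chartFun (𝟙 (ProjCech.PP k 1)) 1 0 =
      (ProjCech.PP k 1).presheaf.map (eqToHom (Dplus_singleton_eq k 0)).op (Motives.ProjLine.sec k 0) := by
  change ProjCech.evalRing (𝟙 (ProjCech.PP k 1)) {0} (ProjCech.tElB k {1} 0) = _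
  rw [ProjCech.evalRing_apply, Scheme.Hom.id_app, ProjCech.awayEquiv_symm_tElB]
  change Proj.awayToSection (ProjCech.grading k 1) (Xs k {0}) _ = _
  symm
  exact map_eqToHom_awayToSection_mk k (Xs_singleton 0)
    (by rw [show ({1} : Finset (Fin 2)).erase 0 = {1} from rfl, Xs_singleton, Finset.card_singleton, pow_one]; rfl) _ _ 1 _ _

/-- **`x₁/x₀` is a prime element of `Γ(ℙ¹_k, D₊(x₀))`** (it generates the maximal ideal of the rational point `(1 : 0)`:
tree `ProjLine.primeIdealOf_y`). [folklore] -/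
theorem prime_chartFun : Prime (SerreTwist.chartFun (𝟙 (ProjCech.PP k 1)) 1 0) := by
  rw [chartFun_eq_sec]
  have hprime : Prime (Motives.ProjLine.sec k 0) := by
    have hne : Motives.ProjLine.sec k 0 ≠ 0 := by
      intro h0
      have := Motives.ProjLine.τ_ne_zero k 0
      rw [← Motives.ProjLine.germToFunctionField_sec, h0, map_zero] at this
      exact this rfl
    rw [← Ideal.span_singleton_prime hne, ← Motives.ProjLine.primeIdealOf_y]
    exact inferInstance
  exact (MulEquiv.prime_iff
    ((ProjCech.PP k 1).presheaf.mapIso (eqToIso (Dplus_singleton_eq k 0)).op).commRingCatIsoToRingEquiv (p := Motives.ProjLine.sec k 0)).mpr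
    hprime

end Charts

/-! ### Line bundles on `ℙ¹_k` are free on the whole standard charts -/

section Frames

variable (k : Type) [Field k]

/-- `Γ(X, V)` is non-trivial for an open `V` containing a point. [folklore] -/
theorem nontrivial_sections_of_mem {X : Scheme.{0}} {V : X.Opens} {x : X} (hx : x ∈ V) :
    Nontrivial Γ(X, V) :=
  (X.presheaf.germ V x hx).hom.domain_nontrivial

/-- **A line bundle on `ℙ¹_k` is free on each standard chart `D₊(x_i)`**: its sections over the affine chart are a finite
projective module over the PID `Γ(D₊(x_i)) ≅ k[T]` (tree `Modules/AffineVectorBundleSections`), hence free (Mathlib),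
of rank one (compare with a rank-one frame at the point `(1:0)`/`(0:1)` of the chart), giving a frame on the whole chart
(tree `KernelFiniteLocallyFree.nonempty_free_iso_over_of_basis`). [folklore] -/
theorem exists_frame_Dplus (L : (ProjCech.PP k 1).Modules)
    (hL : ∀ x : ProjCech.PP k 1, ∃ (W : (ProjCech.PP k 1).Opens) (_ : x ∈ W),
      Nonempty (SheafOfModules.free (Fin 1) ≅ L.over W)) (i : Fin 2) :
    Nonempty (SheafOfModules.free (Fin 1) ≅ L.over (ProjCech.Dplus k 1 {i})) := by
  classical
  have hFL : Motives.IsFiniteLocallyFree L := fun x => by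
    obtain ⟨W, hx, ⟨e⟩⟩ := hL x
    exact ⟨W, hx, Fin 1, inferInstance, ⟨e⟩⟩
  haveI := hFL.isVectorBundle.1
  have hK : IsAffineLocalizing L := IsAffineLocalizing.of_isQuasicoherent L
  have hU : IsAffineOpen (ProjCech.Dplus k 1 {i}) := isAffineOpen_Dplus_singleton k 1 i
  obtain ⟨hfin, hproj⟩ := finite_projective_sections_of_isFiniteLocallyFree hFL hU
  haveI := hfin; haveI := hproj
  haveI := isDomain_sections_Dplus k i
  haveI := isPrincipalIdealRing_sections_Dplus k i
  haveI : Module.Free Γ(ProjCech.PP k 1, ProjCech.Dplus k 1 {i}) Γ(L, ProjCech.Dplus k 1 {i}) := inferInstance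
  let b := Module.Free.chooseBasis Γ(ProjCech.PP k 1, ProjCech.Dplus k 1 {i}) Γ(L, ProjCech.Dplus k 1 {i})
  -- a frame on the whole chart, indexed by the basis
  obtain ⟨eb⟩ := nonempty_free_iso_over_of_basis L hK hU b
  -- its size is one: compare with a rank-one frame at the rational point of the chart
  let x : ProjCech.PP k 1 := Motives.ProjLine.y k i
  have hx : x ∈ ProjCech.Dplus k 1 {i} := by rw [Dplus_singleton_eq]; exact Motives.ProjLine.y_mem k i
  obtain ⟨W, hxW, ⟨e'⟩⟩ := hL x
  haveI : Nontrivial Γ(ProjCech.PP k 1, ProjCech.Dplus k 1 {i} ⊓ W) := nontrivial_sections_of_mem ⟨hx, hxW⟩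
  have hcard : Fintype.card (Module.Free.ChooseBasisIndex Γ(ProjCech.PP k 1, ProjCech.Dplus k 1 {i})
      Γ(L, ProjCech.Dplus k 1 {i})) = 1 :=
    rank_eq_of_nontrivial eb e' (Fintype.equivFin _) (Equiv.refl (Fin 1)) (homOfLE inf_le_left) (homOfLE inf_le_right)
  exact nonempty_free_iso_over_of_basis L hK hU (b.reindex (Fintype.equivFinOfCardEq hcard))

end Frames

/-! ### The transition function of a line bundle on the two standard charts is a power of `x₁/x₀` -/

section Classification

variable (k : Type) [Field k]

/-- The overlap of the two standard charts of `ℙ¹` is the basic open of `x₁/x₀` in `D₊(x₀)` (tree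
`SerreTheoremA.Zop_singleton_inf_eq_basicOpen`). [folklore] -/
theorem Dplus_inf_eq_basicOpen :
    ProjCech.Dplus k 1 {0} ⊓ ProjCech.Dplus k 1 {1} =
      (ProjCech.PP k 1).basicOpen (SerreTwist.chartFun (𝟙 (ProjCech.PP k 1)) 1 0) :=
  SerreTwist.Zop_singleton_inf_eq_basicOpen (𝟙 (ProjCech.PP k 1)) 1 0

variable {k}

/-- For frames of size one the transition functions in the two directions are mutually inverse. [folklore] -/
theorem transition_mul_transition_fin_one {X : Scheme.{0}} {E : X.Modules} {W W' V : X.Opens}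
    (e : SheafOfModules.free (Fin 1) ≅ E.over W) (e' : SheafOfModules.free (Fin 1) ≅ E.over W')
    (κ : V ⟶ W) (κ' : V ⟶ W') :
    transition e e' κ κ' 0 0 * transition e' e κ' κ 0 0 = 1 := by
  have h := congrFun (congrFun (transition_mul_symm e e' κ κ') 0) 0
  rw [Matrix.mul_apply, Fin.sum_univ_one, Matrix.one_apply_eq] at h
  exact h

/-- Basis change for frames of size one: `b'₀| = T₀₀ • b₀|`. [folklore] -/
theorem map_basisSection_fin_one {X : Scheme.{0}} {E : X.Modules} {W W' V : X.Opens}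
    (e : SheafOfModules.free (Fin 1) ≅ E.over W) (e' : SheafOfModules.free (Fin 1) ≅ E.over W')
    (κ : V ⟶ W) (κ' : V ⟶ W') :
    E.presheaf.map κ'.op (basisSection e' 0) = transition e e' κ κ' 0 0 • E.presheaf.map κ.op (basisSection e 0) := by
  rw [map_basisSection_eq_sum_transition e e' κ κ' 0, Fin.sum_univ_one]

/-- The basis section of a frame composed with an automorphism of `E|_W`. [folklore] -/
theorem basisSection_trans {X : Scheme.{0}} {E : X.Modules} {W : X.Opens} {I : Type}
    (e : SheafOfModules.free I ≅ E.over W) (σ : E.over W ≅ E.over W) (i : I) :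
    basisSection (e ≪≫ σ) i = appLE σ.hom (𝟙 W) (basisSection e i) := by
  rw [basisSection, Iso.trans_hom, SheafOfModules.freeHomEquiv_comp_apply, overSectionsEquiv_sectionsMap']
  rfl

variable (k)

set_option maxHeartbeats 400000 in
/-- **`Pic ℙ¹_k` in frame form.** Every line bundle `L` on `ℙ¹_k` (`k` a field; «line bundle» = free of rank one near
every point) admits frames `e₀`, `e₁` on the WHOLE standard charts `D₊(x₀)`, `D₊(x₁)` whose transition function on
`D₊(x₀) ∩ D₊(x₁)` is a monomial in `t = x₁/x₀` and `s = x₀/x₁ = t⁻¹`: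
`T(e₀, e₁) = t^a · s^b` (`a, b ∈ ℕ`, one of them may be taken `0`; so `L ≅ 𝒪(±d)`). Proof: the charts are
`Spec` of the PID `k[T]`, so `L` is free on them (`exists_frame_Dplus`); the transition function is a unit of
`Γ(D₊(x₀x₁)) = Γ(D₊(x₀))[1/t]` with `t` prime (`prime_chartFun`), hence `u · tᵈ` with `u` a unit of `Γ(D₊(x₀))`
(`exists_eq_unit_mul_zpow_of_isUnit`), and `u` is absorbed into `e₀`. No Grothendieck splitting, no degrees of divisors.
[folklore] -/
theorem exists_frames_transition_eq_monomial (L : (ProjCech.PP k 1).Modules)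
    (hL : ∀ x : ProjCech.PP k 1, ∃ (W : (ProjCech.PP k 1).Opens) (_ : x ∈ W),
      Nonempty (SheafOfModules.free (Fin 1) ≅ L.over W)) :
    ∃ (e₀ : SheafOfModules.free (Fin 1) ≅ L.over (ProjCech.Dplus k 1 {0}))
      (e₁ : SheafOfModules.free (Fin 1) ≅ L.over (ProjCech.Dplus k 1 {1})) (a b : ℕ),
      transition e₀ e₁ (homOfLE (inf_le_left : ProjCech.Dplus k 1 {0} ⊓ ProjCech.Dplus k 1 {1} ≤ _))
          (homOfLE (inf_le_right : ProjCech.Dplus k 1 {0} ⊓ ProjCech.Dplus k 1 {1} ≤ _)) 0 0 =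
        (ProjCech.PP k 1).presheaf.map (homOfLE (inf_le_left : ProjCech.Dplus k 1 {0} ⊓ ProjCech.Dplus k 1 {1} ≤ _)).op
            (SerreTwist.chartFun (𝟙 (ProjCech.PP k 1)) 1 0) ^ a *
          (ProjCech.PP k 1).presheaf.map (homOfLE (inf_le_right : ProjCech.Dplus k 1 {0} ⊓ ProjCech.Dplus k 1 {1} ≤ _)).op
            (SerreTwist.chartFun (𝟙 (ProjCech.PP k 1)) 0 1) ^ b := by
  classical
  set t : Γ(ProjCech.PP k 1, ProjCech.Dplus k 1 {0}) := SerreTwist.chartFun (𝟙 (ProjCech.PP k 1)) 1 0 with ht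
  set s : Γ(ProjCech.PP k 1, ProjCech.Dplus k 1 {1}) := SerreTwist.chartFun (𝟙 (ProjCech.PP k 1)) 0 1 with hs
  have hV : ProjCech.Dplus k 1 {0} ⊓ ProjCech.Dplus k 1 {1} = (ProjCech.PP k 1).basicOpen t := Dplus_inf_eq_basicOpen k
  -- frames on the whole charts
  obtain ⟨e₀⟩ := exists_frame_Dplus k L hL 0
  obtain ⟨e₁⟩ := exists_frame_Dplus k L hL 1
  -- work over the basic open `D(t) = U₀ ∩ U₁`, a localization of `Γ(U₀)` at the prime `t`
  have hle₀ : (ProjCech.PP k 1).basicOpen t ≤ ProjCech.Dplus k 1 {0} := (ProjCech.PP k 1).basicOpen_le t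
  have hle₁ : (ProjCech.PP k 1).basicOpen t ≤ ProjCech.Dplus k 1 {1} := by rw [← hV]; exact inf_le_right
  let κ₀ : (ProjCech.PP k 1).basicOpen t ⟶ ProjCech.Dplus k 1 {0} := homOfLE hle₀
  let κ₁ : (ProjCech.PP k 1).basicOpen t ⟶ ProjCech.Dplus k 1 {1} := homOfLE hle₁
  have hU₀aff : IsAffineOpen (ProjCech.Dplus k 1 {0}) := isAffineOpen_Dplus_singleton k 1 0
  haveI : IsLocalization.Away t Γ(ProjCech.PP k 1, (ProjCech.PP k 1).basicOpen t) := hU₀aff.isLocalization_basicOpen t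
  haveI := isDomain_sections_Dplus k 0
  -- the transition function is a unit, hence `u · t^d`
  have hunit : IsUnit (transition e₀ e₁ κ₀ κ₁ 0 0) :=
    IsUnit.of_mul_eq_one _ (transition_mul_transition_fin_one e₀ e₁ κ₀ κ₁)
  obtain ⟨u, d, hud⟩ := exists_eq_unit_mul_zpow_of_isUnit t (prime_chartFun k) hunit
  set tU : Γ(ProjCech.PP k 1, (ProjCech.PP k 1).basicOpen t)ˣ :=
    (IsLocalization.Away.algebraMap_isUnit (S := Γ(ProjCech.PP k 1, (ProjCech.PP k 1).basicOpen t)) t).unit with htU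
  -- absorb `u` into the frame on `U₀`
  let σ : L.over (ProjCech.Dplus k 1 {0}) ≅ L.over (ProjCech.Dplus k 1 {0}) :=
    { hom := overScalar L _ (u : Γ(ProjCech.PP k 1, ProjCech.Dplus k 1 {0}))
      inv := overScalar L _ (↑u⁻¹ : Γ(ProjCech.PP k 1, ProjCech.Dplus k 1 {0}))
      hom_inv_id := by rw [← overScalar_mul, Units.inv_mul, overScalar_one]
      inv_hom_id := by rw [← overScalar_mul, Units.mul_inv, overScalar_one] }
  let e₀' : SheafOfModules.free (Fin 1) ≅ L.over (ProjCech.Dplus k 1 {0}) := e₀ ≪≫ σ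
  have hb₀' : basisSection e₀' 0 = (u : Γ(ProjCech.PP k 1, ProjCech.Dplus k 1 {0})) • basisSection e₀ 0 := by
    rw [basisSection_trans, appLE_overScalar, op_id, (ProjCech.PP k 1).presheaf.map_id]; rfl
  -- the new transition function is `t^d`
  have hT' : transition e₀' e₁ κ₀ κ₁ 0 0 = ((tU ^ d : Γ(ProjCech.PP k 1, (ProjCech.PP k 1).basicOpen t)ˣ) :
      Γ(ProjCech.PP k 1, (ProjCech.PP k 1).basicOpen t)) := by
    have h1 := map_basisSection_fin_one e₀ e₁ κ₀ κ₁
    have hb : L.presheaf.map κ₀.op (basisSection e₀ 0) =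
        (ProjCech.PP k 1).presheaf.map κ₀.op (↑u⁻¹ : Γ(ProjCech.PP k 1, ProjCech.Dplus k 1 {0})) •
          L.presheaf.map κ₀.op (basisSection e₀' 0) := by
      rw [hb₀', Scheme.Modules.map_smul, smul_smul, ← map_mul, Units.inv_mul, map_one, one_smul]
    rw [hb, smul_smul, hud] at h1
    have hcoef : algebraMap Γ(ProjCech.PP k 1, ProjCech.Dplus k 1 {0}) Γ(ProjCech.PP k 1, (ProjCech.PP k 1).basicOpen t) ↑u *
        ↑(tU ^ d) * (ProjCech.PP k 1).presheaf.map κ₀.op (↑u⁻¹ : Γ(ProjCech.PP k 1, ProjCech.Dplus k 1 {0})) = ↑(tU ^ d) := by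
      have hum : algebraMap Γ(ProjCech.PP k 1, ProjCech.Dplus k 1 {0}) Γ(ProjCech.PP k 1, (ProjCech.PP k 1).basicOpen t) ↑u *
          (ProjCech.PP k 1).presheaf.map κ₀.op (↑u⁻¹ : Γ(ProjCech.PP k 1, ProjCech.Dplus k 1 {0})) = 1 := by
        change (ProjCech.PP k 1).presheaf.map κ₀.op (↑u : Γ(ProjCech.PP k 1, ProjCech.Dplus k 1 {0})) * _ = 1
        rw [← map_mul, Units.mul_inv, map_one]
      rw [mul_assoc, mul_comm (↑(tU ^ d) : Γ(ProjCech.PP k 1, (ProjCech.PP k 1).basicOpen t)), ← mul_assoc, hum, one_mul]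
    rw [hcoef] at h1
    rw [transition_apply, h1, coord_smul, coord_map_basisSection, if_pos rfl, mul_one]
  -- read `t^d` as a monomial in `t|` and `s| = t|⁻¹`
  have hts : (ProjCech.PP k 1).presheaf.map κ₁.op s * (ProjCech.PP k 1).presheaf.map κ₀.op t = 1 :=
    SerreTwist.chartFun_mul_symm (𝟙 (ProjCech.PP k 1)) 0 1 hle₀ hle₁
  have htU_val : (tU : Γ(ProjCech.PP k 1, (ProjCech.PP k 1).basicOpen t)) = (ProjCech.PP k 1).presheaf.map κ₀.op t := rfl
  have htU_inv : ((tU⁻¹ : Γ(ProjCech.PP k 1, (ProjCech.PP k 1).basicOpen t)ˣ) : Γ(ProjCech.PP k 1, (ProjCech.PP k 1).basicOpen t)) =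
      (ProjCech.PP k 1).presheaf.map κ₁.op s :=
    Units.inv_eq_of_mul_eq_one_right (by rw [htU_val, mul_comm, hts])
  have hmono : ∃ a b : ℕ, ((tU ^ d : Γ(ProjCech.PP k 1, (ProjCech.PP k 1).basicOpen t)ˣ) :
      Γ(ProjCech.PP k 1, (ProjCech.PP k 1).basicOpen t)) =
      (ProjCech.PP k 1).presheaf.map κ₀.op t ^ a * (ProjCech.PP k 1).presheaf.map κ₁.op s ^ b := by
    obtain ⟨n, rfl | rfl⟩ := Int.eq_nat_or_neg d
    · exact ⟨n, 0, by rw [zpow_natCast, Units.val_pow_eq_pow_val, htU_val, pow_zero, mul_one]⟩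
    · exact ⟨0, n, by rw [zpow_neg, zpow_natCast, ← inv_pow, Units.val_pow_eq_pow_val, htU_inv, pow_zero, one_mul]⟩
  obtain ⟨a, b, hab⟩ := hmono
  refine ⟨e₀', e₁, a, b, ?_⟩
  -- transport from `D(t)` to `U₀ ∩ U₁` along the equality of opens
  let l : ProjCech.Dplus k 1 {0} ⊓ ProjCech.Dplus k 1 {1} ⟶ (ProjCech.PP k 1).basicOpen t := eqToHom hV
  have H1 : transition e₀' e₁ (homOfLE (inf_le_left : ProjCech.Dplus k 1 {0} ⊓ ProjCech.Dplus k 1 {1} ≤ _))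
      (homOfLE (inf_le_right : ProjCech.Dplus k 1 {0} ⊓ ProjCech.Dplus k 1 {1} ≤ _)) 0 0 =
      (ProjCech.PP k 1).presheaf.map l.op (transition e₀' e₁ κ₀ κ₁ 0 0) := by
    have h := congrFun (congrFun (transition_map e₀' e₁ κ₀ κ₁ l) 0) 0
    rw [Matrix.map_apply] at h
    rw [show homOfLE (inf_le_left : ProjCech.Dplus k 1 {0} ⊓ ProjCech.Dplus k 1 {1} ≤ _) = l ≫ κ₀ from
        Subsingleton.elim _ _,
      show homOfLE (inf_le_right : ProjCech.Dplus k 1 {0} ⊓ ProjCech.Dplus k 1 {1} ≤ _) = l ≫ κ₁ from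
        Subsingleton.elim _ _]
    exact h.symm
  have H2 : ∀ {W : (ProjCech.PP k 1).Opens} (κ : (ProjCech.PP k 1).basicOpen t ⟶ W)
      (κ' : ProjCech.Dplus k 1 {0} ⊓ ProjCech.Dplus k 1 {1} ⟶ W) (r : Γ(ProjCech.PP k 1, W)),
      (ProjCech.PP k 1).presheaf.map l.op ((ProjCech.PP k 1).presheaf.map κ.op r) =
        (ProjCech.PP k 1).presheaf.map κ'.op r := by
    intro W κ κ' r
    rw [← CategoryTheory.comp_apply, ← Functor.map_comp]
    have hφ : κ.op ≫ l.op = κ'.op := congrArg Quiver.Hom.op (Subsingleton.elim (l ≫ κ) κ')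
    rw [hφ]
  rw [H1, hT', hab, map_mul, map_pow, map_pow, H2 κ₀ (homOfLE inf_le_left) t, H2 κ₁ (homOfLE inf_le_right) s]

end Classification

end Summit.ResolutionOfSingularities.ResolutionOfSingularities.Cruxes.EquisingularLiftNat.P1VB

end
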